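import Mathlib
import HarnessLib
import Summits.HubbardSuperconductivity.HubbardSuperconductivity.Theorems.KLProgrammeKLRegimeEngineTowerBlockIncrWt
import Summits.HubbardSuperconductivity.HubbardSuperconductivity.Theorems.KLProgrammeKLRegimeEngineTowerDoorToKit
import Summits.HubbardSuperconductivity.HubbardSuperconductivity.Theorems.KLProgrammeKLRegimeEngineTowerDoorToKitFO
import Summits.HubbardSuperconductivity.HubbardSuperconductivity.Theorems.KLProgrammeKLRegimeEngineTowerBlockIncrWtKit
import Summits.HubbardSuperconductivity.HubbardSuperconductivity.Theorems.KLProgrammeKLRegimeEngineV8E5BlockTrivial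

/-!
# Route `KLProgramme` — crux K3 ENGINE (stmt-HubbardSuperconductivity-20437 `KLRegimeEngineV17F2`), stub (b) v2, THE LEVELS PACKAGE (ℓ):
# instantiation (I1), BLOCK `0` OF THE TOWER, weighted track — the born weighted pinned sums of `Δ_0 = 𝒱_d − 𝒱_0` from the scale-`0` action read in the
# TRIVIAL one-sector family (E1-LEVELS-BLUEPRINT v5 §1 (β) «block 0's own step»; cell gate-hubbard-kl, seat hubbard-kl-k3c2-p3 g12 as SUBSTITUTE typer while the
#  E1 lineage is unseated — E1 may rename or supersede)

Every block-step row of the tower so far (`…EngineTowerBlockStepWt/Lev/WtFull`, `…BlockIncrWt*`, `…BlockIncr*Kit`) takes `1 ≤ k`: the input `𝒱_{dk}` is analysed in the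
thin family `F_{dk−1}`, whose plateau `{t ≤ Λ_{dk}}` carries the block covariance.  For block `0` no thin family exists (`F_0`'s plateau is `{t ≤ Λ_1}`, while the first
slice `(Λ_1, Λ_0]` of the block lies outside it).  The generic plateau doors (`Literature/…/SectorisedIncrementBoundGradedWeightedPlateau`,
`…BinomialWeightedPlateau`) do NOT need a thin family: with the TRIVIAL one-sector family `F = F̃ := trivialMultiplier` (§1: `1·1 = 1`, `Σ_{Fin 1} 1 = 1`) all four
plateau hypotheses hold for EVERY covariance and EVERY output family.  So `Δ_0 = effAction(C^K_{(Λ_d, Λ_0]}) 𝒱_0 − 𝒱_0` is ONE block step from the scale-`0` action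
`𝒱_0[K]` analysed in the trivial family (its sizes = the PLAIN position-space sizes, E1's UV datum `klTowerUVWt`, …TowerModelDefs §4), output at any `F_{J′}`:

* §1 the plateau facts `hCpl`/`hF'pl` of the trivial family (its fat/sum facts `trivialMultiplier_mul_self`, `sum_trivialMultiplier`,
  `trivialMultiplier_eq_zero_of_sum_eq_zero` are p5 g7's, …V8E5BlockTrivial — imported, not restated);
* §2 **`klWtPinnedSumOf_klTowerIncr_zero_le`** — for `Z^K_{Λ_0} ≠ 0` and the block-`0` constants as binders (Gram `κ` and WEIGHTED rows/cols `α` of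
  `S(1)ᵀ C^K_{(Λ_d,Λ_0]} S(1)` — plain slice decay over `d` scales —, WEIGHTED overlap `(cr, cc)` of `E(F_{J′})·S(1)`, `ρ`, `θ < 1`), weighted PLAIN input sizes `B m′` of `𝒱_0`
  (tree weight `klScaleWt L M β J′`, leg maps `latticeLegPos`): `klWtPinnedSumOf … J′ (2(q+1)) Δ_0 i w″ ≤ ε^{2q+1}·(graded RHS + binomial RHS)` — the `k = 0` twin of
  E1's `klWtPinnedSumOf_klTowerIncr_le` (p578846);
* §3 **`klWtPinnedSumOf_klTowerIncr_zero_le_kit`** (E1's dictionary `doorGraded_le_kitStep`/`doorBinomial_le_towerFO`, kit guard replaces `θ < 1`, sizes `N m′ = ε^{2m′}·B m′`,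
  `N 0 = 0`) and the carrier row **`klTowerBornWt_zero_le_kit`** (`klTowerBornWt … d 0 (2(q+1)) ≤ …`, born family `F_0`).
Compositions of landed theorems; nothing about the model is asserted beyond them; nothing asserts (ℓ), any stub, K3 or superconductivity.
References: BGM 2006 §2.7 (2.70)–(2.71a), §2.8 (2.76)–(2.84), §3 (3.2)–(3.8) [cite: BenfattoGiulianiMastropietro2006].
-/

noncomputable section

namespace Summit.HubbardSuperconductivity.HubbardSuperconductivity.Theorems.EngineV8

set_option linter.dupNamespace false -- summit = problem name (single-conjunct summit), D-0017

open Real Finset Literature.MathematicalPhysics.QuantumLattice Literature.Probability.LatticeModels GrassmannAlgebra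
open Summit.HubbardSuperconductivity.HubbardSuperconductivity.Theorems.KLProgrammeLegKernels
open Summit.HubbardSuperconductivity.HubbardSuperconductivity.Theorems.KLRegimeSplit
open Summit.HubbardSuperconductivity.HubbardSuperconductivity.Theorems.KLRegimeWick
open Summit.HubbardSuperconductivity.HubbardSuperconductivity.Theorems.TwoPointAssembly
open Literature.Probability.LatticeModels.BattleFederbush

variable {L M : ℕ}

/-! ## §1 The trivial one-sector family: plateau facts (fat/sum facts from …V8E5BlockTrivial) -/

/-- `hCpl` for the trivial family: EVERY covariance lives in its plateau. -/
theorem sum_trivialMultiplier_eq_one_of_ne_zero (C : Matrix (HubbardFieldIdx L M) (HubbardFieldIdx L M) ℂ) (X Y : HubbardFieldIdx L M)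
    (_h : C X Y ≠ 0) : ∑ ω, trivialMultiplier L M ω X.1.1 = 1 ∧ ∑ ω, trivialMultiplier L M ω Y.1.1 = 1 :=
  ⟨sum_trivialMultiplier _, sum_trivialMultiplier _⟩

/-- `hF'pl` for the trivial family: EVERY output family lives in its plateau. -/
theorem sum_trivialMultiplier_eq_one_of_family_ne_zero {N' : ℕ} (F' : Fin N' → FreqMomentum L M → ℂ) (ω' : Fin N') (k : FreqMomentum L M)
    (_h : F' ω' k ≠ 0) : ∑ ω, trivialMultiplier L M ω k = 1 :=
  sum_trivialMultiplier _

/-! ## §2 The born weighted pinned sums of `Δ_0` (door form) -/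

section Born

variable [NeZero L] [NeZero M]

/-- **THE BORN WEIGHTED SIZES OF BLOCK `0`'S INCREMENT** (blueprint v5 §1 (β), weighted track, model half).  `1 ≤ d`, `Z^K_{Λ_0} ≠ 0`; block-`0` constants as hypotheses
at the TRIVIAL input family (Gram `κ` and weighted `α` of `S(1)ᵀ C^K_{(Λ_d, Λ_0]} S(1)`, weighted overlap `(cr, cc)` of `E(F_{J′})·S(1)`, `ρ`, `θ < 1`); weighted PLAIN input
sizes `B m′` of `𝒱_0[K]`.  Then in every even degree `2(q+1)`, at every output family `F_{J′}` and every pin: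
`klWtPinnedSumOf … J′ (2(q+1)) Δ_0 i w″ ≤ ε^{2q+1}·(graded RHS + binomial RHS)` (label type of the inputs: `SpaceTimeIdx × SectorLeg 1`). -/
theorem klWtPinnedSumOf_klTowerIncr_zero_le {β : ℝ} (hβ : 0 < β) (U μ : ℝ) (K : TrigPolyC4v) (d J' : ℕ)
    (hZ : hubbardEffPartitionFnCT L M β U μ 0 K (klScale klE0 0) ≠ 0)
    {κ : ℝ} (hκ : 0 < κ)
    (hGB : IsGramBoundedR ((sectorSubMatrix L M β (trivialMultiplier L M)).transpose *
      hubbardCovSliceCT L M β μ 0 K (klScale klE0 d) (klScale klE0 0) * sectorSubMatrix L M β (trivialMultiplier L M)) κ)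
    (B : ℕ → ℝ) (hB0 : ∀ m', 0 ≤ B m')
    (hB : ∀ (m' : ℕ) (j : Fin (2 * m')) (w : SpaceTimeIdx L M × SectorLeg 1),
      ∑ Y ∈ univ.filter (fun Y : Fin (2 * m') → SpaceTimeIdx L M × SectorLeg 1 => Y j = w),
        klScaleWt L M β J' ((univ.image Y).image (latticeLegPos (2 * (2 * M)))) *
          ‖kernel ℂ (ExteriorAlgebra.map (Matrix.toLin' (sectorAnalysisMatrix L M β (trivialMultiplier L M)))
            (klEffectiveAction L M β U μ K klE0 0)) (2 * m') Y‖ ≤ B m')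
    {α : ℝ} (hα : 0 < α)
    (hrow : ∀ X, ∑ Y, ‖((sectorSubMatrix L M β (trivialMultiplier L M)).transpose *
        hubbardCovSliceCT L M β μ 0 K (klScale klE0 d) (klScale klE0 0) * sectorSubMatrix L M β (trivialMultiplier L M)) X Y‖ *
        klScaleWt L M β J' {latticeLegPos (2 * (2 * M)) X, latticeLegPos (2 * (2 * M)) Y} ≤ α)
    (hcol : ∀ Y, ∑ X, ‖((sectorSubMatrix L M β (trivialMultiplier L M)).transpose *
        hubbardCovSliceCT L M β μ 0 K (klScale klE0 d) (klScale klE0 0) * sectorSubMatrix L M β (trivialMultiplier L M)) X Y‖ *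
        klScaleWt L M β J' {latticeLegPos (2 * (2 * M)) X, latticeLegPos (2 * (2 * M)) Y} ≤ α)
    {ρ : ℝ} (hρ : 0 < ρ)
    (hθ : Real.exp 1 * α * normV (SpaceTimeIdx L M × SectorLeg 1) κ ρ (fun m' => imagTimeWeight β M ^ (2 * m') * B m') / κ ^ 2 < 1)
    {cr cc : ℝ} (hcc0 : 0 ≤ cc)
    (hrow' : ∀ X'', ∑ X', ‖(sectorAnalysisMatrix L M β (klAnisoFamily L M β μ K klE0 J') *
        sectorSubMatrix L M β (trivialMultiplier L M)) X'' X'‖ *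
        klScaleWt L M β J' {latticeLegPos (2 * (2 * M)) X'', latticeLegPos (2 * (2 * M)) X'} ≤ cr)
    (hcol' : ∀ X', ∑ X'', ‖(sectorAnalysisMatrix L M β (klAnisoFamily L M β μ K klE0 J') *
        sectorSubMatrix L M β (trivialMultiplier L M)) X'' X'‖ *
        klScaleWt L M β J' {latticeLegPos (2 * (2 * M)) X'', latticeLegPos (2 * (2 * M)) X'} ≤ cc)
    {N₀ : ℕ} (hN₀ : 2 ≤ N₀) (q : ℕ) (i : Fin (2 * (q + 1))) (w'' : SpaceTimeIdx L M × SectorLeg (sectorCount J')) :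
    klWtPinnedSumOf L M β μ K J' (2 * (q + 1)) (klTowerIncr L M β U μ K d 0) i w'' ≤
      imagTimeWeight β M ^ (2 * q + 1) *
        (cr * cc ^ (2 * q + 1) *
          (∑ n ∈ Ico 2 N₀, (ρ⁻¹ ^ (2 * q + 1 + 1) * κ⁻¹ ^ (2 * (n - 1)) * (α ^ (n - 1) * Real.exp n)) *
              ∑ δ ∈ (Fintype.piFinset fun _ : Fin n => range (Fintype.card (SpaceTimeIdx L M × SectorLeg 1) / 2 + 1)) with
                  2 * q + 1 + 1 + 2 * (n - 1) ≤ ∑ a, 2 * δ a,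
                ∏ a, (Real.exp 2 * (κ + ρ)) ^ (2 * δ a) * (imagTimeWeight β M ^ (2 * δ a) * B (δ a)) +
            ρ⁻¹ ^ (2 * q + 1 + 1) *
              (Real.exp 1 * normV (SpaceTimeIdx L M × SectorLeg 1) κ ρ (fun m' => imagTimeWeight β M ^ (2 * m') * B m')) *
              (Real.exp 1 * α * normV (SpaceTimeIdx L M × SectorLeg 1) κ ρ (fun m' => imagTimeWeight β M ^ (2 * m') * B m') / κ ^ 2) ^ (N₀ - 1) /
              (1 - Real.exp 1 * α * normV (SpaceTimeIdx L M × SectorLeg 1) κ ρ (fun m' => imagTimeWeight β M ^ (2 * m') * B m') / κ ^ 2)) +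
        cr * cc ^ (2 * q + 1) *
          ∑ m' ∈ range (Fintype.card (SpaceTimeIdx L M × SectorLeg 1) / 2 + 1),
            (if q + 1 < m' then ((2 * m').choose (2 * (q + 1)) : ℝ) * κ ^ (2 * m' - 2 * (q + 1)) *
              (imagTimeWeight β M ^ (2 * m') * B m') else 0)) := by
  have hβ' : β ≠ 0 := hβ.ne'
  have hε : 0 ≤ imagTimeWeight β M := imagTimeWeight_nonneg hβ.le M
  have hwt := isTreeWeight_klScaleWt L M hβ.le J'
  have hG : klEffectiveAction L M β U μ K klE0 0 ∈ evenPart ℂ (HubbardFieldIdx L M) := klEffectiveAction_mem_evenPart hβ' U μ K klE0 0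
  have hG0 : constPart ℂ (klEffectiveAction L M β U μ K klE0 0) = 0 := constPart_klEffectiveAction_eq_zero β U μ K klE0 0 hZ
  -- `Δ_0` as one Gaussian step from `𝒱_0`, orders ≥ 2 plus first order
  have hZ' : hubbardEffPartitionFnCT L M β U μ 0 K (klScale klE0 (d * 0)) ≠ 0 := by rwa [Nat.mul_zero]
  have hΔ := klTowerIncr_eq_ordersGe2_add_firstOrder β U μ K d 0 hZ'
  simp only [Nat.mul_zero, zero_add, mul_one, klTowerInput] at hΔ
  -- the two generic doors at the trivial input family
  have h2 := sum_wt_norm_sectorAnalysis_effAction_sub_gaussConv_le_graded_of_plateau hwt (latticeLegPos (2 * (2 * M))) (latticeLegPos (2 * (2 * M))) hβ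
    (trivialMultiplier L M) (trivialMultiplier L M) trivialMultiplier_mul_self trivialMultiplier_eq_zero_of_sum_eq_zero
    (klAnisoFamily L M β μ K klE0 J') (klEffectiveAction L M β U μ K klE0 0) hG hG0 _
    (sum_trivialMultiplier_eq_one_of_ne_zero (hubbardCovSliceCT L M β μ 0 K (klScale klE0 d) (klScale klE0 0)))
    (sum_trivialMultiplier_eq_one_of_family_ne_zero (klAnisoFamily L M β μ K klE0 J'))
    hκ hGB B hB0 hB hα hrow hcol hρ hθ hcc0 hrow' hcol' hN₀ (2 * q + 1) i w''
  have h1 := sum_wt_norm_sectorAnalysis_gaussConv_sub_le_binomial_of_plateau hwt (latticeLegPos (2 * (2 * M))) (latticeLegPos (2 * (2 * M))) hβ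
    (trivialMultiplier L M) (trivialMultiplier L M) trivialMultiplier_mul_self trivialMultiplier_eq_zero_of_sum_eq_zero
    (klAnisoFamily L M β μ K klE0 J') (klEffectiveAction L M β U μ K klE0 0) hG _
    (sum_trivialMultiplier_eq_one_of_ne_zero (hubbardCovSliceCT L M β μ 0 K (klScale klE0 d) (klScale klE0 0)))
    (sum_trivialMultiplier_eq_one_of_family_ne_zero (klAnisoFamily L M β μ K klE0 J'))
    hκ.le hGB B hB0 hB hcc0 hrow' hcol' q i w''
  rw [hΔ]
  refine (klWtPinnedSumOf_add_le hβ.le μ K J' _ _ _ i w'').trans ?_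
  rw [mul_add (imagTimeWeight β M ^ (2 * q + 1))]
  exact add_le_add
    ((klWtPinnedSumOf_succ β μ K J' (2 * q + 1) _ i w'').trans_le (mul_le_mul_of_nonneg_left h2 (pow_nonneg hε _)))
    ((klWtPinnedSumOf_succ β μ K J' (2 * q + 1) _ i w'').trans_le (mul_le_mul_of_nonneg_left h1 (pow_nonneg hε _)))

/-! ## §3 Kit form and the carrier row at the born family `F_0` -/

/-- **BLOCK `0`'S BORN WEIGHTED PINNED SUMS IN KIT FORM** — §2 with the door guard replaced by the KIT guard `(eα/κ²)·towerV D τ N < 1` (`τ = (e²(κ+ρ))²`,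
absolute sizes `N m′ := ε^{2m′}·B m′` with `B 0 = 0`, degree cap `D ≥ |Γ|/2`, `Γ = SpaceTimeIdx × SectorLeg 1`); E1's dictionary `doorGraded_le_kitStep` /
`doorBinomial_le_towerFO`. -/
theorem klWtPinnedSumOf_klTowerIncr_zero_le_kit {β : ℝ} (hβ : 0 < β) (U μ : ℝ) (K : TrigPolyC4v) (d J' : ℕ)
    (hZ : hubbardEffPartitionFnCT L M β U μ 0 K (klScale klE0 0) ≠ 0)
    {κ : ℝ} (hκ : 0 < κ)
    (hGB : IsGramBoundedR ((sectorSubMatrix L M β (trivialMultiplier L M)).transpose *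
      hubbardCovSliceCT L M β μ 0 K (klScale klE0 d) (klScale klE0 0) * sectorSubMatrix L M β (trivialMultiplier L M)) κ)
    (B : ℕ → ℝ) (hB0 : ∀ m', 0 ≤ B m') (hB00 : B 0 = 0)
    (hB : ∀ (m' : ℕ) (j : Fin (2 * m')) (w : SpaceTimeIdx L M × SectorLeg 1),
      ∑ Y ∈ univ.filter (fun Y : Fin (2 * m') → SpaceTimeIdx L M × SectorLeg 1 => Y j = w),
        klScaleWt L M β J' ((univ.image Y).image (latticeLegPos (2 * (2 * M)))) *
          ‖kernel ℂ (ExteriorAlgebra.map (Matrix.toLin' (sectorAnalysisMatrix L M β (trivialMultiplier L M)))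
            (klEffectiveAction L M β U μ K klE0 0)) (2 * m') Y‖ ≤ B m')
    {α : ℝ} (hα : 0 < α)
    (hrow : ∀ X, ∑ Y, ‖((sectorSubMatrix L M β (trivialMultiplier L M)).transpose *
        hubbardCovSliceCT L M β μ 0 K (klScale klE0 d) (klScale klE0 0) * sectorSubMatrix L M β (trivialMultiplier L M)) X Y‖ *
        klScaleWt L M β J' {latticeLegPos (2 * (2 * M)) X, latticeLegPos (2 * (2 * M)) Y} ≤ α)
    (hcol : ∀ Y, ∑ X, ‖((sectorSubMatrix L M β (trivialMultiplier L M)).transpose *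
        hubbardCovSliceCT L M β μ 0 K (klScale klE0 d) (klScale klE0 0) * sectorSubMatrix L M β (trivialMultiplier L M)) X Y‖ *
        klScaleWt L M β J' {latticeLegPos (2 * (2 * M)) X, latticeLegPos (2 * (2 * M)) Y} ≤ α)
    {ρ : ℝ} (hρ : 0 < ρ)
    {cr cc : ℝ} (hcr0 : 0 ≤ cr) (hcc0 : 0 ≤ cc)
    (hrow' : ∀ X'', ∑ X', ‖(sectorAnalysisMatrix L M β (klAnisoFamily L M β μ K klE0 J') *
        sectorSubMatrix L M β (trivialMultiplier L M)) X'' X'‖ *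
        klScaleWt L M β J' {latticeLegPos (2 * (2 * M)) X'', latticeLegPos (2 * (2 * M)) X'} ≤ cr)
    (hcol' : ∀ X', ∑ X'', ‖(sectorAnalysisMatrix L M β (klAnisoFamily L M β μ K klE0 J') *
        sectorSubMatrix L M β (trivialMultiplier L M)) X'' X'‖ *
        klScaleWt L M β J' {latticeLegPos (2 * (2 * M)) X'', latticeLegPos (2 * (2 * M)) X'} ≤ cc)
    {N₀ : ℕ} (hN₀ : 2 ≤ N₀) {D : ℕ} (hD : Fintype.card (SpaceTimeIdx L M × SectorLeg 1) / 2 ≤ D)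
    (hguard : Real.exp 1 * α / κ ^ 2 * towerV D ((Real.exp 2 * (κ + ρ)) ^ 2) (fun m' => imagTimeWeight β M ^ (2 * m') * B m') < 1)
    (q : ℕ) (i : Fin (2 * (q + 1))) (w'' : SpaceTimeIdx L M × SectorLeg (sectorCount J')) :
    klWtPinnedSumOf L M β μ K J' (2 * (q + 1)) (klTowerIncr L M β U μ K d 0) i w'' ≤
      imagTimeWeight β M ^ (2 * q + 1) * (cr * cc ^ (2 * q + 1) *
        (towerFO D (κ ^ 2) (fun m' => imagTimeWeight β M ^ (2 * m') * B m') (q + 1) +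
          ∑ n ∈ Icc 2 (N₀ - 1), Real.exp 1 * (Real.exp 1 * α / κ ^ 2) ^ (n - 1) * (ρ⁻¹ ^ 2) ^ (q + 1) *
            towerS D ((Real.exp 2 * (κ + ρ)) ^ 2) (fun m' => imagTimeWeight β M ^ (2 * m') * B m') n (q + 1) +
          (ρ⁻¹ ^ 2) ^ (q + 1) * Real.exp 1 * towerV D ((Real.exp 2 * (κ + ρ)) ^ 2) (fun m' => imagTimeWeight β M ^ (2 * m') * B m') *
            (Real.exp 1 * α / κ ^ 2 * towerV D ((Real.exp 2 * (κ + ρ)) ^ 2) (fun m' => imagTimeWeight β M ^ (2 * m') * B m')) ^ (N₀ - 1) /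
            (1 - Real.exp 1 * α / κ ^ 2 * towerV D ((Real.exp 2 * (κ + ρ)) ^ 2) (fun m' => imagTimeWeight β M ^ (2 * m') * B m')))) := by
  have hε : 0 ≤ imagTimeWeight β M := imagTimeWeight_nonneg hβ.le M
  have hN0 : ∀ m', 0 ≤ imagTimeWeight β M ^ (2 * m') * B m' := fun m' => mul_nonneg (pow_nonneg hε _) (hB0 m')
  have hN00 : imagTimeWeight β M ^ (2 * 0) * B 0 = 0 := by rw [hB00, mul_zero]
  -- the door guard from the kit guard
  have hV := normV_le_towerV (Γ := SpaceTimeIdx L M × SectorLeg 1) hκ.le hρ.le hN0 hN00 hD (κ := κ) (ρ := ρ)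
  have hθ : Real.exp 1 * α * normV (SpaceTimeIdx L M × SectorLeg 1) κ ρ (fun m' => imagTimeWeight β M ^ (2 * m') * B m') / κ ^ 2 < 1 := by
    have hΦ0 : 0 ≤ Real.exp 1 * α / κ ^ 2 := by positivity
    calc Real.exp 1 * α * normV (SpaceTimeIdx L M × SectorLeg 1) κ ρ (fun m' => imagTimeWeight β M ^ (2 * m') * B m') / κ ^ 2
        = Real.exp 1 * α / κ ^ 2 * normV (SpaceTimeIdx L M × SectorLeg 1) κ ρ (fun m' => imagTimeWeight β M ^ (2 * m') * B m') := by ring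
      _ ≤ Real.exp 1 * α / κ ^ 2 * towerV D ((Real.exp 2 * (κ + ρ)) ^ 2) (fun m' => imagTimeWeight β M ^ (2 * m') * B m') :=
          mul_le_mul_of_nonneg_left hV hΦ0
      _ < 1 := hguard
  have hmain := klWtPinnedSumOf_klTowerIncr_zero_le (L := L) (M := M) hβ U μ K d J' hZ hκ hGB B hB0 hB hα hrow hcol hρ hθ hcc0 hrow' hcol' hN₀ q i w''
  have hkit := towerNumerics_doorBrackets_le_kit (Γ := SpaceTimeIdx L M × SectorLeg 1) hκ hρ hα.le hcr0 hcc0 hN0 hN00 hD hN₀ q hguard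
  exact hmain.trans (mul_le_mul_of_nonneg_left hkit (pow_nonneg hε _))

/-- **BLOCK `0`'S BORN WEIGHTED ARRAY IN KIT FORM** (carrier row at the born family `F_0`, `J′ = 0`): `klTowerBornWt … d 0 (2(q+1)) ≤ ε^{2q+1}·cr·cc^{2q+1}·(towerFO + Σ + tail)`
— the `k = 0` complement of k3c3-p2 g13's `klTowerBornWtAt_le_kit` / E1's block rows (`ciSup` over the pins). -/
theorem klTowerBornWt_zero_le_kit {β : ℝ} (hβ : 0 < β) (U μ : ℝ) (K : TrigPolyC4v) (d : ℕ)
    (hZ : hubbardEffPartitionFnCT L M β U μ 0 K (klScale klE0 0) ≠ 0)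
    {κ : ℝ} (hκ : 0 < κ)
    (hGB : IsGramBoundedR ((sectorSubMatrix L M β (trivialMultiplier L M)).transpose *
      hubbardCovSliceCT L M β μ 0 K (klScale klE0 d) (klScale klE0 0) * sectorSubMatrix L M β (trivialMultiplier L M)) κ)
    (B : ℕ → ℝ) (hB0 : ∀ m', 0 ≤ B m') (hB00 : B 0 = 0)
    (hB : ∀ (m' : ℕ) (j : Fin (2 * m')) (w : SpaceTimeIdx L M × SectorLeg 1),
      ∑ Y ∈ univ.filter (fun Y : Fin (2 * m') → SpaceTimeIdx L M × SectorLeg 1 => Y j = w),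
        klScaleWt L M β 0 ((univ.image Y).image (latticeLegPos (2 * (2 * M)))) *
          ‖kernel ℂ (ExteriorAlgebra.map (Matrix.toLin' (sectorAnalysisMatrix L M β (trivialMultiplier L M)))
            (klEffectiveAction L M β U μ K klE0 0)) (2 * m') Y‖ ≤ B m')
    {α : ℝ} (hα : 0 < α)
    (hrow : ∀ X, ∑ Y, ‖((sectorSubMatrix L M β (trivialMultiplier L M)).transpose *
        hubbardCovSliceCT L M β μ 0 K (klScale klE0 d) (klScale klE0 0) * sectorSubMatrix L M β (trivialMultiplier L M)) X Y‖ *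
        klScaleWt L M β 0 {latticeLegPos (2 * (2 * M)) X, latticeLegPos (2 * (2 * M)) Y} ≤ α)
    (hcol : ∀ Y, ∑ X, ‖((sectorSubMatrix L M β (trivialMultiplier L M)).transpose *
        hubbardCovSliceCT L M β μ 0 K (klScale klE0 d) (klScale klE0 0) * sectorSubMatrix L M β (trivialMultiplier L M)) X Y‖ *
        klScaleWt L M β 0 {latticeLegPos (2 * (2 * M)) X, latticeLegPos (2 * (2 * M)) Y} ≤ α)
    {ρ : ℝ} (hρ : 0 < ρ)
    {cr cc : ℝ} (hcr0 : 0 ≤ cr) (hcc0 : 0 ≤ cc)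
    (hrow' : ∀ X'', ∑ X', ‖(sectorAnalysisMatrix L M β (klAnisoFamily L M β μ K klE0 0) *
        sectorSubMatrix L M β (trivialMultiplier L M)) X'' X'‖ *
        klScaleWt L M β 0 {latticeLegPos (2 * (2 * M)) X'', latticeLegPos (2 * (2 * M)) X'} ≤ cr)
    (hcol' : ∀ X', ∑ X'', ‖(sectorAnalysisMatrix L M β (klAnisoFamily L M β μ K klE0 0) *
        sectorSubMatrix L M β (trivialMultiplier L M)) X'' X'‖ *
        klScaleWt L M β 0 {latticeLegPos (2 * (2 * M)) X'', latticeLegPos (2 * (2 * M)) X'} ≤ cc)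
    {N₀ : ℕ} (hN₀ : 2 ≤ N₀) {D : ℕ} (hD : Fintype.card (SpaceTimeIdx L M × SectorLeg 1) / 2 ≤ D)
    (hguard : Real.exp 1 * α / κ ^ 2 * towerV D ((Real.exp 2 * (κ + ρ)) ^ 2) (fun m' => imagTimeWeight β M ^ (2 * m') * B m') < 1)
    (q : ℕ) :
    klTowerBornWt L M β U μ K d 0 (2 * (q + 1)) ≤
      imagTimeWeight β M ^ (2 * q + 1) * (cr * cc ^ (2 * q + 1) *
        (towerFO D (κ ^ 2) (fun m' => imagTimeWeight β M ^ (2 * m') * B m') (q + 1) +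
          ∑ n ∈ Icc 2 (N₀ - 1), Real.exp 1 * (Real.exp 1 * α / κ ^ 2) ^ (n - 1) * (ρ⁻¹ ^ 2) ^ (q + 1) *
            towerS D ((Real.exp 2 * (κ + ρ)) ^ 2) (fun m' => imagTimeWeight β M ^ (2 * m') * B m') n (q + 1) +
          (ρ⁻¹ ^ 2) ^ (q + 1) * Real.exp 1 * towerV D ((Real.exp 2 * (κ + ρ)) ^ 2) (fun m' => imagTimeWeight β M ^ (2 * m') * B m') *
            (Real.exp 1 * α / κ ^ 2 * towerV D ((Real.exp 2 * (κ + ρ)) ^ 2) (fun m' => imagTimeWeight β M ^ (2 * m') * B m')) ^ (N₀ - 1) /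
            (1 - Real.exp 1 * α / κ ^ 2 * towerV D ((Real.exp 2 * (κ + ρ)) ^ 2) (fun m' => imagTimeWeight β M ^ (2 * m') * B m')))) := by
  haveI : NeZero (sectorCount (d * 0)) := ⟨(sectorCount_pos _).ne'⟩
  haveI : Nonempty (Fin (2 * (q + 1)) × (SpaceTimeIdx L M × SectorLeg (sectorCount (d * 0)))) :=
    ⟨(⟨0, by omega⟩, (Classical.arbitrary _, ((0, 0), 0)))⟩
  unfold klTowerBornWt
  refine ciSup_le fun qw => ?_
  have h := klWtPinnedSumOf_klTowerIncr_zero_le_kit (L := L) (M := M) hβ U μ K d (d * 0) hZ hκ hGB B hB0 hB00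
    (by simpa only [Nat.mul_zero] using hB) hα (by simpa only [Nat.mul_zero] using hrow) (by simpa only [Nat.mul_zero] using hcol) hρ hcr0 hcc0
    (by simpa only [Nat.mul_zero] using hrow') (by simpa only [Nat.mul_zero] using hcol') hN₀ hD hguard q qw.1 qw.2
  exact h

end Born

end Summit.HubbardSuperconductivity.HubbardSuperconductivity.Theorems.EngineV8

end
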